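import Literature.NumberTheory.Automorphic.ReciprocityGLnPotentialModularity
import Literature.NumberTheory.EllipticCurves.Isogeny

/-!
# CM elliptic curves over totally real fields are automorphic of weight zero (named fact)

For a totally real number field `K` and an integral Weierstrass model `E / 𝓞 K` with `Δ(E) ≠ 0` whose
generic fibre has (geometric) complex multiplication by an order of an imaginary quadratic field `M`
(`M ⊄ K` since `K` is totally real), Deuring's theorem gives `L(E/K, s) = L(s, ψ)` for the
Grössencharacter `ψ = ψ_{E/KM}` of `KM` attached to `E` (Silverman, *Advanced Topics*, Thm. II.10.5(b);
`ψ` is unramified exactly above the places of good reduction, Thm. II.9.2(b)), and the automorphic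
induction `π = π(ψ)` from `GL₁(𝔸_{KM})` to `GL₂(𝔸_K)` (Hecke, Jacquet–Langlands §12, Shalika–Tanaka;
Gelbart, Thm. 7.11 `λ ↦ π(λ)` and Thm. 7.12 `π(λ) = π(Ind λ)`) is CUSPIDAL (as `ψ ≠ ψ^c`: the infinity
types differ), of parallel weight `2` (`HasWeightZero`), unramified at every finite place `w ∤ Δ(E)`
(there `E` has good reduction, `KM ⊆ K(E[N])` is unramified at `w` for `N ≥ 3` prime to `w` by
Néron–Ogg–Shafarevich, and `ψ` is unramified above `w`), with Hecke polynomial `X² - a_w(E) X + q_w`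
at such `w` (`L_w(E, s) = L_w(s, ψ)`).  In the tree's vocabulary this is exactly
`IsAutomorphicOfWeightZero E` (`ReciprocityGLnPotentialModularity`: a weight-zero cuspidal `π` of
`GL₂(𝔸_K)` with Hecke polynomial `X² - a_w X + q_w` at EVERY `w ∤ Δ(E)`), under the hypothesis
`(E.baseChange K).HasCM` (`Isogeny`: geometric CM).

Rendering and faithfulness.  The carrier `IsAutomorphicOfWeightZero` asks for the Hecke polynomial at
every place not dividing the discriminant of the MODEL, which is weaker than (implied by) matching at
every place of good reduction of the curve, so the fact as typed is implied by the printed statements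
and never stronger.  The total reality of `K` is only used to guarantee `M ⊄ K` (so that `KM/K` is a
quadratic extension and `π(ψ)` is an induction from a quadratic extension); the printed theorems hold
for any number field `K` not containing `M`.  A named fact (D-0014): users take
`(h : CMAutomorphyTotallyReal)`; first consumer: the Langlands-summit residual bookkeeping
`Summits/Langlands/Langlands/Theorems/WeakStrongBridgeQuarticLift.lean` (its CM branch over quartic
fields containing `√5`).
-- TODO(general form): any number field `K` with `M ⊄ K`; and the finer statement `r_ι(π) ≅ ρ_{E,ℓ}`
-- (full local–global compatibility at every place), which the tree does not yet have language for
-- on the automorphic side beyond Hecke polynomials at unramified places.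
-/

open scoped NumberField
open NumberField

namespace Literature.NumberTheory.Automorphic

/-- **CM elliptic curves over totally real fields are automorphic of weight zero** (Deuring + automorphic
induction of the CM Grössencharacter).  For `K` totally real and an integral model `E / 𝓞 K` with
`Δ(E) ≠ 0` whose generic fibre has geometric complex multiplication, there is a cuspidal automorphic
representation `π` of `GL₂(𝔸_K)` of weight zero with Hecke polynomial `X² - a_w(E) X + q_w` at every
finite place `w ∤ Δ(E)` — i.e. `IsAutomorphicOfWeightZero E`.  Proof in print: `L(E/K,s) = L(s, ψ_{E/KM})`
(Deuring; Silverman ATAEC Thm. II.10.5(b), II.9.2(b)) and `π := π(ψ_{E/KM})` (Jacquet–Langlands §12;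
Gelbart Thm. 7.11, 7.12), cuspidal since `ψ ≠ ψ^c`.
[cite: Deuring1953, Hauptsatz] [cite: SilvermanATAEC1994, Thm. II.10.5(b) and Thm. II.9.2(b)]
[cite: Gelbart1975, Thm. 7.11 and Thm. 7.12] [cite: JacquetLanglands1970, §12] -/
def CMAutomorphyTotallyReal : Prop :=
  ∀ (K : Type) [Field K] [NumberField K] [IsTotallyReal K] (E : WeierstrassCurve (𝓞 K)), E.Δ ≠ 0 →
    (E.baseChange K).HasCM → IsAutomorphicOfWeightZero E

end Literature.NumberTheory.Automorphic
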